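import Literature.AlgebraicGeometry.HodgeTheory.AtiyahClassCoherentNaturality
import Literature.AlgebraicGeometry.Modules.SheafHomTranspose
import HarnessLib

/-!
# Comparison of the two Atiyah classes: `At(E) ∈ Ext¹(E, 𝓗om(E^∨, Ω¹))` vs the torsion-safe
# `At'(E) ∈ Ext¹(E, 𝓗om(𝒯, E))`

The tree carries two models of `E ⊗ Ω¹_{X/S}` for an `𝒪_X`-module `E` on an `S`-scheme `X`, each with
an Atiyah (jet) extension: `twistCotangent E = 𝓗om(E^∨, Ω¹)` with `atiyahClass E`
(`HodgeTheory/AtiyahClass.lean`) and `twistTangentHom E = 𝓗om(𝒯, E)`, `𝒯 = (Ω¹)^∨`, with `atiyahClass' E`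
(`HodgeTheory/AtiyahClassCoherent.lean`). Their comparison was recorded as missing in both files and in
`HodgeTheory/AtiyahPowers.lean`. We prove it here, INVERSE-FREE and for EVERY module `E`, by mapping
both jet sequences to the torsion-safe jet sequence of the double dual `E^∨∨`:

* `jetShortComplexCompare E : jetShortComplex E ⟶ jetShortComplexCoh E^∨∨` — on the kernels the
  transpose `𝓗om(E^∨, Ω¹) → 𝓗om(𝒯, E^∨∨)`, `φ ↦ φ^∨` (`Modules/SheafHomTranspose.lean`,
  `transposeDual`), on the middle `(s, φ) ↦ (ev_s, φ^∨)` (`jetCompareMap`), on the quotients the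
  biduality map `ev^E : E → E^∨∨` (`Modules.toBidual`); the twisting terms match:
  `δ(a, s)^∨ = δ'(a, ev_s)` (`precompOver_deltaHom`);
* `jetShortComplexCohMap ev^E : jetShortComplexCoh E ⟶ jetShortComplexCoh E^∨∨` (functoriality,
  `HodgeTheory/AtiyahClassCoherentNaturality.lean`).

Naturality of `ShortExact.extClass` along both gives the **comparison identity**

  `atiyahClass_compare : At(E) · (φ ↦ φ^∨) = At'(E) · 𝓗om(𝒯, ev^E)`  in `Ext¹(E, 𝓗om(𝒯, E^∨∨))`,

valid for every `E`; when `E` and `Ω¹_{X/S}` are finite locally free both comparison maps are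
ISOMORPHISMS (`isIso_twistTranspose`: `Modules.isIso_transposeDual`; `isIso_sheafHomMap_toBidual`:
`Modules.isIso_toBidual`, Hartshorne II Ex. 5.1), and `atiyahClass'_eq` expresses `At'(E)` as the image
of `At(E)` under the resulting isomorphism `𝓗om(E^∨, Ω¹) ≅ 𝓗om(𝒯, E)` — the faithfulness of the
torsion-safe model on vector bundles. Everything is proved; no named facts.

## References

* M. F. Atiyah, *Complex analytic connections in fibre bundles*, Trans. AMS 85 (1957), §4, Prop. 6–7.
  [Atiyah1957]
* R.-O. Buchweitz, H. Flenner, Compositio Math. 137 (2003), §1, §3 (the Atiyah class `At(F) ∈ Ext¹(F, F ⊗ Ω¹)`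
  of any coherent `F`). [BuchweitzFlenner2003]
* R. Hartshorne, *Algebraic Geometry* (1977), II Ex. 5.1 (a), (b). [Hartshorne1977]
-/

noncomputable section

open CategoryTheory CategoryTheory.Abelian AlgebraicGeometry Opposite TopologicalSpace Limits

namespace Literature.AlgebraicGeometry.HodgeTheory

open Literature.AlgebraicGeometry.Modules Literature.AlgebraicGeometry.Motives

universe w u

section Compare

variable {S : Type u} [CommRing S] {X : Over (Spec (CommRingCat.of S))}
variable (E : X.left.Modules) {U : X.left.Opens}

/-- **The transpose of twists** `𝓗om(E^∨, Ω¹) → 𝓗om(𝒯, E^∨∨)`, `φ ↦ φ^∨` (`𝒯 = (Ω¹)^∨`): the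
internal transpose `Modules.transposeDual E^∨ Ω¹`. [cite: Hartshorne1977, II Ex. 5.1 (b)] -/
abbrev twistTranspose : twistCotangent E ⟶ twistTangentHom (dual (dual E)) :=
  transposeDual (dual E) (cotangentSheaf X)

/-- Extensionality for torsion-safe jet sections (local copy; the library's is private). [folklore] -/
private lemma jetSectionsCoh_ext' {F : X.left.Modules} {p q : JetSectionsCoh F U}
    (h₁ : p.fst = q.fst) (h₂ : p.snd = q.snd) : p = q :=
  Prod.ext h₁ h₂

/-- **The twisting terms correspond under transposition**: `δ(a, s)^∨ = δ'(a, ev_s)`, i.e.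
`(λ ↦ λ(s) da)^∨ = (θ ↦ θ(da) ev_s)` as morphisms `𝒯|_U → E^∨∨|_U` — on a tangent field `θ` and a
functional `λ` both give `λ(s) θ(da)`. [cite: Atiyah1957, §4 (the module structure of D(E))] -/
theorem precompOver_deltaHom (a : Γ(X.left, U)) (s : Γ(E, U)) :
    precompOver (unitModule X.left) (deltaHom E U a s) =
      deltaHomCoh (dual (dual E)) U a ((toBidual E (unitModule X.left)).app U s) := by
  refine hom_ext_of_appLE fun W k
    (θ : (cotangentSheaf X).over W ⟶ (unitModule X.left).over W) => ?_
  rw [appLE_precompOver, deltaHomCoh, appLE_comp, appLE_evalAt, appLE_smulSection,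
    toBidual_app_apply]
  -- both sides are sections of `E^∨∨` over `W`, i.e. morphisms `E^∨|_W → 𝒪|_W`; compare their values
  change (restrictHom k (deltaHom E U a s) ≫ θ : (dual E).over W ⟶ (unitModule X.left).over W) =
    (show Γ(X.left, W) from
        appLE θ (𝟙 W) ((cotangentSheaf X).presheaf.map k.op (dSection X U a))) •
      restrictHom k (evalAt (M := unitModule X.left) s)
  refine hom_ext_of_appLE fun W' l (μ : E.over W' ⟶ (unitModule X.left).over W') => ?_
  rw [appLE_comp, appLE_restrictHom, deltaHom, appLE_comp, appLE_evalAt, appLE_smulSection,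
    appLE_smul_right, appLE_smul, appLE_restrictHom, appLE_evalAt]
  -- `θ(da)|_{W'} = θ|_{W'}(da|_{W'})`
  have hc : (X.left.presheaf.map l.op
        (appLE θ (𝟙 W) ((cotangentSheaf X).presheaf.map k.op (dSection X U a))) : Γ(X.left, W')) =
      appLE θ l ((cotangentSheaf X).presheaf.map (l ≫ k).op (dSection X U a)) := by
    have h := appLE_map θ (𝟙 W) l ((cotangentSheaf X).presheaf.map k.op (dSection X U a))
    rw [Category.comp_id, presheaf_map_map] at h
    exact h.symm
  -- `μ(s|) · θ(da|) = θ(da|) · μ(s|)` in the commutative ring `Γ(X, W')`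
  change (show Γ(X.left, W') from appLE μ (𝟙 W') (E.presheaf.map (l ≫ k).op s)) *
      (show Γ(X.left, W') from
        appLE θ l ((cotangentSheaf X).presheaf.map (l ≫ k).op (dSection X U a))) =
    (X.left.presheaf.map l.op (show Γ(X.left, W) from
        appLE θ (𝟙 W) ((cotangentSheaf X).presheaf.map k.op (dSection X U a)))) *
      (show Γ(X.left, W') from appLE μ (𝟙 W') (E.presheaf.map (l ≫ k).op s))
  refine (mul_comm _ _).trans ?_
  congr 1
  exact hc.symm

/-- **The comparison map on jet modules** `P¹(E) → P¹_coh(E^∨∨)`, `(s, φ) ↦ (ev_s, φ^∨)`; it is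
`𝒪_X`-linear for the two twisted structures because the twisting terms correspond
(`precompOver_deltaHom`). [cite: Atiyah1957, Prop. 6 (functoriality of D(E))] -/
def jetCompareMap : jetModule E ⟶ jetModuleCoh (dual (dual E)) where
  val := PresheafOfModules.homMk
    { app := fun U => AddCommGrpCat.ofHom
        { toFun := fun p : JetSections E U.unop =>
            (JetSectionsCoh.mk ((toBidual E (unitModule X.left)).app U.unop p.fst)
              (precompOver (unitModule X.left) p.snd) : JetSectionsCoh (dual (dual E)) U.unop)
          map_zero' := jetSectionsCoh_ext' (map_zero ((toBidual E (unitModule X.left)).app U.unop).hom)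
            (precompOver_zero (unitModule X.left))
          map_add' := fun p q => jetSectionsCoh_ext'
            (map_add ((toBidual E (unitModule X.left)).app U.unop).hom p.fst q.fst)
            (precompOver_add (unitModule X.left) p.snd q.snd) }
      naturality := fun {U V} i =>
        AddCommGrpCat.ext fun (p : JetSections E U.unop) => jetSectionsCoh_ext'
          (PresheafOfModules.naturality_apply (toBidual E (unitModule X.left)).val i p.fst)
          (restrictHom_precompOver (unitModule X.left) i.unop p.snd).symm }
    (fun U (a : Γ(X.left, U.unop)) (p : JetSections E U.unop) => jetSectionsCoh_ext'
      (Scheme.Modules.Hom.app_smul (toBidual E (unitModule X.left)) a p.fst)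
      (by
        change precompOver (unitModule X.left) (a • p.snd + deltaHom E U.unop a p.fst) =
          a • precompOver (unitModule X.left) p.snd +
            deltaHomCoh (dual (dual E)) U.unop a ((toBidual E (unitModule X.left)).app U.unop p.fst)
        rw [precompOver_add, precompOver_smul, precompOver_deltaHom]))

/-- **The morphism of Atiyah sequences** `jetShortComplex E ⟶ jetShortComplexCoh E^∨∨`: transpose on
the kernels, `(s, φ) ↦ (ev_s, φ^∨)` in the middle, biduality `ev^E` on the quotients.
[cite: Atiyah1957, Prop. 6–7 (functoriality of the extension 𝔅(E))] -/
def jetShortComplexCompare : jetShortComplex E ⟶ jetShortComplexCoh (dual (dual E)) where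
  τ₁ := twistTranspose E
  τ₂ := jetCompareMap E
  τ₃ := toBidual E (unitModule X.left)
  comm₁₂ := Scheme.Modules.hom_ext _ _ fun U => AddCommGrpCat.ext
    fun (_ : (dual E).over U ⟶ (cotangentSheaf X).over U) => jetSectionsCoh_ext'
      (map_zero ((toBidual E (unitModule X.left)).app U).hom).symm rfl
  comm₂₃ := Scheme.Modules.hom_ext _ _ fun U => AddCommGrpCat.ext fun (_ : JetSections E U) => rfl

variable [HasExt.{w} X.left.Modules]

/-- Naturality of `extClass` along `jetShortComplexCompare`:
`At(E) · (φ ↦ φ^∨) = ev^E · At'(E^∨∨)` in `Ext¹(E, 𝓗om(𝒯, E^∨∨))`. [cite: BuchweitzFlenner2003, §3 (Atiyah class, functoriality)] [cite: Atiyah1957, Prop. 7] -/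
theorem atiyahClass_comp_twistTranspose :
    (atiyahClass E).comp (Ext.mk₀ (twistTranspose E)) (add_zero 1) =
      (Ext.mk₀ (toBidual E (unitModule X.left))).comp (atiyahClass'.{w} (dual (dual E))) (zero_add 1) :=
  (jetShortComplex_shortExact E).extClass_naturality (jetShortComplexCoh_shortExact (dual (dual E)))
    (jetShortComplexCompare E)

/-- **Comparison of the two Atiyah classes** (every `𝒪_X`-module `E`, inverse-free):
`At(E) · (φ ↦ φ^∨) = At'(E) · 𝓗om(𝒯, ev^E)` in `Ext¹(E, 𝓗om(𝒯, E^∨∨))` — both sides equal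
`ev^E · At'(E^∨∨)` (`atiyahClass_comp_twistTranspose`, `atiyahClass'_naturality`). When `E` and `Ω¹`
are finite locally free the two comparison maps are isomorphisms (`isIso_twistTranspose`,
`isIso_sheafHomMap_toBidual`). [cite: BuchweitzFlenner2003, §1 and §3 (At(F) ∈ Ext¹(F, F ⊗ Ω¹))] [cite: Atiyah1957, §4] -/
theorem atiyahClass_compare :
    (atiyahClass E).comp (Ext.mk₀ (twistTranspose E)) (add_zero 1) =
      (atiyahClass'.{w} E).comp
        (Ext.mk₀ (sheafHomMap (tangentSheaf X) (toBidual E (unitModule X.left)))) (add_zero 1) := by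
  rw [atiyahClass'_naturality]
  exact atiyahClass_comp_twistTranspose E

omit [HasExt.{w} X.left.Modules] in
/-- For `E^∨` and `Ω¹_{X/S}` finite locally free (e.g. `E` a vector bundle on a smooth `X/S`), the
transpose of twists `𝓗om(E^∨, Ω¹) → 𝓗om(𝒯, E^∨∨)` is an isomorphism. [cite: Hartshorne1977, II Ex. 5.1 (b)] -/
theorem isIso_twistTranspose (hE : IsFiniteLocallyFree E)
    (hΩ : IsFiniteLocallyFree (cotangentSheaf X)) : IsIso (twistTranspose E) :=
  isIso_transposeDual (dual E) (cotangentSheaf X) (isFiniteLocallyFree_dual hE) hΩ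

omit [HasExt.{w} X.left.Modules] in
/-- For `E` finite locally free, `𝓗om(𝒯, ev^E) : 𝓗om(𝒯, E) → 𝓗om(𝒯, E^∨∨)` is an isomorphism
(biduality, Hartshorne II Ex. 5.1 (a), under the functor `𝓗om(𝒯, –)`). [cite: Hartshorne1977, II Ex. 5.1 (a)] -/
theorem isIso_sheafHomMap_toBidual (hE : IsFiniteLocallyFree E) :
    IsIso (sheafHomMap (tangentSheaf X) (toBidual E (unitModule X.left))) := by
  haveI := isIso_toBidual E hE
  exact (inferInstance : IsIso ((sheafHomFunctor (tangentSheaf X)).map (toBidual E (unitModule X.left))))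

/-- **Faithfulness of the torsion-safe Atiyah class on vector bundles**: for `E` and `Ω¹_{X/S}`
finite locally free, `At'(E)` is the image of `At(E)` under the isomorphism
`𝓗om(E^∨, Ω¹) ⥲ 𝓗om(𝒯, E^∨∨) ⥲ 𝓗om(𝒯, E)` (transpose, then `𝓗om(𝒯, (ev^E)⁻¹)`). [cite: BuchweitzFlenner2003, §1 and §3] [cite: Hartshorne1977, II Ex. 5.1] -/
theorem atiyahClass'_eq (hE : IsFiniteLocallyFree E) :
    atiyahClass'.{w} E =
      haveI := isIso_sheafHomMap_toBidual E hE
      (atiyahClass E).comp (Ext.mk₀ (twistTranspose E ≫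
        inv (sheafHomMap (tangentSheaf X) (toBidual E (unitModule X.left))))) (add_zero 1) := by
  haveI := isIso_sheafHomMap_toBidual E hE
  rw [← Ext.mk₀_comp_mk₀, ← Ext.comp_assoc_of_second_deg_zero, atiyahClass_compare,
    Ext.comp_assoc_of_second_deg_zero, Ext.mk₀_comp_mk₀, IsIso.hom_inv_id, Ext.comp_mk₀_id]

end Compare

end Literature.AlgebraicGeometry.HodgeTheory

end
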